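import Mathlib
import HarnessLib
import HarnessLib.Audit
import Summits.NavierStokesRegularity.Statement
import Literature.Analysis.FluidPDE.ClassicalSolution
import Literature.Analysis.FluidPDE.LerayHopf
import Literature.Analysis.FluidPDE.SuitableWeak
import Literature.Analysis.FluidPDE.SelfSimilar
import Literature.Analysis.FluidPDE.KochTataru
import Literature.Analysis.FluidPDE.WeakSolution
import Literature.Analysis.FluidPDE.VectorCalculus
import Literature.Analysis.FluidPDE.MildSolution
import Literature.Analysis.FluidPDE.NSWave0
import Literature.Analysis.FluidPDE.TypeIAncientMild
import Summits.NavierStokesRegularity.NavierStokesRegularity.Theorems.TypeICertificateLadderNoBlowupToClay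
import Summits.NavierStokesRegularity.NavierStokesRegularity.Theorems.SymmetryModuliCountLiouvilleKillsTypeI
import HarnessLib.Audit.Status.Attr

/-!
Route: ParabolicDriftLiouville

# Route ParabolicDriftLiouville — Passive drift–Stokes Liouville in the pointwise parabolic class,
for every drift size, forces the Type-I ancient Liouville theorem

It suffices to show X = ParabolicDriftLiouville, given the declared shared residual NoTypeII
(= stmt-NavierStokesRegularity-0056) and the routine support DiagonalContainment. FREEZE THE DRIFT:
for every smooth divergence-free drift b on ℝ³ × (−∞,0) of parabolic size |b(x,t)| ≤ A/√(T−t)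
(T > 0, ANY A), every smooth divergence-free ancient solution u of the PASSIVE drift–Stokes equation
∂ₜu − Δu + ℙ∇·(b ⊗ u) = 0, taken in the KNSS mild (Oseen-kernel) form with the drift in the first
kernel slot, and of parabolic size |u(x,t)| ≤ C/√(T−t), vanishes identically. On the diagonal b := u
this is exactly the Type-I ancient Liouville theorem TypeIAncientLiouville (shared target stmt-4050,
after the time shift t ↦ t − 1 and the proved BackwardEndVanishing stmt-14064): DiagonalContainment.
With NoTypeII and the PROVED frame theorems symmetryModuliCount_liouvilleKillsTypeI_proof
(stmt-4056)
and typeICertificateLadder_noBlowupToClay_proof (stmt-0055) this gives Clay (A). Realises sketch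
mwave/parabolic-drift-liouville (reader PASS 3/3/4/5) and re-targets card
linear-liouville-drifted-stokes.
Lean: `∀ (A C T : ℝ) (b u : ℝ → EuclideanSpace ℝ (Fin 3) → EuclideanSpace ℝ (Fin 3)), 0 < T →
ContDiffOn ℝ (⊤ : ℕ∞) (Function.uncurry b) (Set.Iio 0 ×ˢ Set.univ) → (∀ t < 0,
Literature.Analysis.FluidPDE.VectorCalculus.IsDivFree (b t)) → (∀ t < 0, ∀ x, ‖b t x‖ ≤ A /
Real.sqrt (T - t)) → ContDiffOn ℝ (⊤ : ℕ∞) (Function.uncurry u) (Set.Iio 0 ×ˢ Set.univ) → (∀ t < 0,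
Literature.Analysis.FluidPDE.VectorCalculus.IsDivFree (u t)) → (∀ s t : ℝ, s < t → t < 0 → ∀ x, u t
x = Literature.Analysis.FluidPDE.heatFlow (u s) (t - s) x - ∫ τ in Set.Ioo s t, ∫ y,
Literature.Analysis.FluidPDE.oseenKernel (t - τ) (x - y) (b τ y) (u τ y)) → (∀ t < 0, ∀ x, ‖u t x‖ ≤
C / Real.sqrt (T - t)) → ∀ t < 0, ∀ x, u t x = 0`

## Assembly
Pure logic over two PROVED frame theorems, certified in Sketch.lean / glue.lean (theorem closes,
lean
check rc 0, 0 sorry): from h₁ : ParabolicDriftLiouville and h₂ : DiagonalContainment get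
hX : TypeIAncientLiouville := h₂ h₁; typeICertificateLadder_noBlowupToClay_proof (stmt-0055) reduces
Clay (A) to "no maximal smooth Leray–Hopf solution from rapidly decaying data stops at a finite T";
given such a solution stopping at T, h₃ : NoTypeII makes the blow-up Type-I and
symmetryModuliCount_liouvilleKillsTypeI_proof (stmt-4056) fed with hX excludes Type-I blow-up —
contradiction. `theorem closes (h₁ : ParabolicDriftLiouville) (h₂ : DiagonalContainment) (h₃ :
NoTypeII) : NavierStokesRegularity`.

Rationale: WHY THIS LINE. The Type-I tier of the problem is reduced in the tree to ONE Liouville theorem for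
Type-I ancient mild
solutions (stmt-4050; frame 4056/0055 proved), and every attack on it so far fights the quadratic
self-interaction. This line replaces the nonlinear Liouville by a LINEAR one: the ancient solution
is a
passive vector transported by an arbitrary divergence-free drift of the same parabolic size, so the
object is a fixed non-autonomous linear operator u ↦ −𝒦_b u (drifted Oseen–Volterra operator) and
the
claim is that it has no non-zero fixed point in the critical weighted space sup √(T−t)|u| < ∞ — a
spectral / fixed-point statement, importing similarity variables (Ornstein–Uhlenbeck–Stokes operator
𝒜_B = −Δ + (y/2)·∇ + A ℙ∇·(B ⊗ ·)), non-self-adjoint spectral exclusion in the strip −3/4 ≤ Re μ ≤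
−1/2,
and the divergence-free-drift regularity theory of SereginSilvestreSverakZlatos2012 (scalar drifts,
drift-independent bounds). The perturbative end is a theorem in this folder (BC5 rung: contraction
for
A ≤ 1/(16 C₀), C₀ = oseenSliceConst, KochNadirashviliSereginSverak2009 §4). The programme "Type-I
bound
⇒ regularity via a Liouville theorem for the Stokes system with drift" is printed by
Schonbek–Seregin
(arXiv:1609.09736, duality / forward decay of the dual problem) and proved there only for small
drift
constant; what this line does that print and prior routes do not: it states the PRIMAL backward
Liouville
with drift AND solution in the pointwise parabolic class (T > 0 gauge) for ALL A as a typed crux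
whose
diagonal provably contains stmt-4050, and staffs its negation (one certified eigenvalue of 𝒜_B in
the
strip kills it) — no listed route freezes the drift (LinearLiouvilleSeven / FiniteTangentModuliMild
linearise AT u, a different operator), and none of the five negatives of the summit is
passive/linear.

RANKED CRUXES. #0 TypeIAncientLiouville (target) — (SHARED stmt-NavierStokesRegularity-4050,
verbatim) every smooth divergence-free KNSS-mild ancient solution of Navier–Stokes on ℝ³ × (−∞,0)
with the Type-I time decay |u(x,t)| ≤ C/√(−t) vanishes identically. (why it might fail: a
non-trivial Type-I ancient mild solution (a backward DSS/rotating breather, or the blow-down of a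
Type-I singularity, Albritton–Barker Thm 1.1) would refute it; the Leray-projected similarity
operator's strain branch drifts toward the decay window for large Type-I constant.)
[KochNadirashviliSereginSverak2009, AlbrittonBarkerJMFM2019, PineauVicol2026, Seregin2014Notes]
#2 ParabolicDriftLiouville (crux) — (deciding crux; card linear-liouville-drifted-stokes C1
re-targeted to the parabolic class) for all reals A, C and T > 0, every smooth divergence-free drift
b on ℝ³ × (−∞,0) with |b(x,t)| ≤ A/√(T−t) and every smooth divergence-free u with |u(x,t)| ≤
C/√(T−t) satisfying the drifted KNSS mild identity u(t) = e^{(t−s)Δ}u(s) − ∫ₛᵗ∫ K(t−τ, x−y)(b(τ,y),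
u(τ,y)) dy dτ for all s < t < 0 (K = the tree's oseenKernel, drift in the first slot): u ≡ 0 on t <
0. [difficulty: XL] (why it might fail: A is scale-critical: for large A nothing excludes an
eigenvalue μ of the non-self-adjoint OU–Stokes operator −Δ+(y/2)·∇+Aℙ∇·(B⊗·) with −3/4 ≤ Re μ ≤
−1/2, i.e. a passive self-similar mode u=(1−t)^μ W(x/√(1−t)) in the class; the sketch's Galerkin
strain-branch fit reaches the strip near A≈400.) [arXiv:1609.09736, arXiv:1707.01986,
SereginSilvestreSverakZlatos2012, KochNadirashviliSereginSverak2009, paper:arxiv-2506.14533]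
#3 NoTypeII (crux) — (SHARED stmt-NavierStokesRegularity-0056, verbatim; the declared RESIDUAL of
this route) every maximal smooth Leray–Hopf solution from rapidly decaying data that stops at a
finite time T blows up at least at the Type-I rate there (no Type-II-only blow-up) — the complement
of the Type-I tier, imported, not attacked here. [difficulty: open-problem] (why it might fail:
Type-II blow-up (rate faster than (T−t)^{-1/2}) is exactly what Tao's averaged Navier–Stokes
exhibits and what Hou's 2022 axisymmetric numerics suggest for true NS; no mechanism of this route
bears on it.) [Tao2016AveragedNS, Hou2022PotentiallySingularNS, BarkerPrange2021]
#9 DiagonalContainment (support) — the diagonal embedding b := u: ParabolicDriftLiouville implies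
TypeIAncientLiouville (time shift t ↦ t−1 puts a Type-I ancient mild solution into the parabolic
class with T = 1, A = C; the passive Liouville kills it on t < −1; the proved BackwardEndVanishing
stmt-14064 finishes). Proved in the seat's Sketch.lean (diagonalContainment_holds, 20 lines) — kept
as an open support binder of `closes` for a prover to land. [difficulty: provable-now]
[KochNadirashviliSereginSverak2009, AlbrittonBarkerJMFM2019]

TWO-LAYER PLAN. Foreseen glued split of ParabolicDriftLiouville once work starts (registered as the
birth skeleton
Cruxes/ParabolicDriftLiouville/Lines/birth.lean, 3 stubs, composition kernel-checked):
PDL ⇐ Scaling (unit-time statement ⇒ all T > 0, parabolic rescaling; M) → PastRepresentation (unit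
class ⇒ full-past Volterra fixed point u = −𝒦_b u; M/L) → FullPastLiouvilleUnit (the fixed-point
equation has no non-zero solution in the unit parabolic class, all A; XL, load-bearing) → PDL.
A later regime split of FullPastLiouvilleUnit by drift size (A ≤ ε proved: the BC5 rung; A large:
similarity-variable spectral exclusion) is layer 2, not filed now.

KILL CRITERIA. Refutation of ParabolicDriftLiouville — an explicit non-zero passive ancient solution
in the class, in
practice ONE certified eigenvalue μ with −3/4 ≤ Re μ ≤ −1/2 (Gaussian-decaying eigenfunction) of
𝒜_B for ONE smooth divergence-free profile B — closes the route `refuted:ParabolicDriftLiouville`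
(no pivot inside this route: the diagonal statement stmt-4050 lives on in SymmetryModuliCount, and
the
refuting drift is itself informative: it exhibits the passive mechanism a Type-I blow-up would
need).
Refutation of NoTypeII (a Type-II blow-up) kills every Type-I-tier route including this one.
TypeIAncientLiouville proved elsewhere ⇒ this route is superseded (close --reason superseded).

NOT DECOMPOSED YET. The large-A core (FullPastLiouvilleUnit) is deliberately one node: its natural
children — (i) Gaussian
far-field decay of would-be eigenfunctions in similarity variables, (ii) exclusion of the strip
−3/4 ≤ Re μ ≤ −1/2 for the autonomous (self-similar-drift) shadow, (iii) passage from autonomous to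
general non-autonomous drifts (evolution-family / Floquet-type argument) — need the OU–Stokes
eigenpair
predicate that Lean lacks and are layer-2 children after the skeleton's first two stubs close.
Constants
(C₀, the contraction threshold 1/(16 C₀)) are fixed by the rung and not re-litigated.

CHEAPEST FALSIFIER. The sketch's Hermite-modulated Galerkin scan (N = 5, D ∈ {44, 52, 60}) of the
similarity operator
𝒜_B for the Gaussian-modulated cubic profile W = e^{−r²/2.803²}(2.825 + 0.094z − 0.315z² − 2.049z³),
A ∈ {100, 200, 400}: the strain-branch fit μ(A) ≈ 0.196 − 0.159 ln(A/5) predicts entry into the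
strip
−3/4 ≤ Re μ ≤ −1/2 near A ≈ 380–400; a converged eigenvalue there, then an interval-arithmetic
enclosure
(kit job → certificate), refutes ParabolicDriftLiouville outright. Not run by this seat (typing
seat; the
disprover runs it first). The perturbative end was run instead and is a THEOREM:
bc/ParabolicDriftLiouville_rung.lean
(A ≤ 1/(16 C₀) ⇒ u ≡ 0; lean check rc 0, 0 sorry).

NUMBERS. Rung threshold ε = 1/(16 C₀), C₀ = Literature.Analysis.FluidPDE.oseenSliceConst (slice
bound
‖B(a,b)(t)‖ ≤ C₀ M_a M_b · 2√(t−s), KochNadirashviliSereginSverak2009 §4 p. 8); contraction factor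
1/2 + 4 C₀ A ≤ 3/4 with the window s = t − 3(T−t). Printed analogue: Schonbek–Seregin smallness
4 c_* c_d < 1 (arXiv:1609.09736 §5). Decay strip for passive self-similar modes: −3/4 ≤ Re μ ≤ −1/2
(sketch). In-tree analogue for the LINEARISED class: Theorems.tangent_eq_zero_of_small_drift (C ≤
c₀).

DEFINITION REQUESTS. None for filing (every item types over heatFlow / oseenKernel / IsDivFree /
HasTypeITimeDecay).
For the kill path only (disprover's business, per the reader verdict): an eigenpair / spectral-strip
predicate for the Ornstein–Uhlenbeck–Stokes operator 𝒜_B in similarity variables and an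
interval-arithmetic certificate format for a Galerkin eigenvalue enclosure — not requested now.

Novelty: Searches (2026-08-17): lit search --hybrid "Liouville theorem Stokes system divergence-free drift
bounded ancient solutions" (10 docs;
[corpus:book:seregin2014-lecture-notes-regularity-theory-navier-stokes-equations p.113] "Conjecture:
any mild bounded ancient solution is a constant", p.127); lit search '"Stokes system with drift"
Liouville' --source all (local 1: [corpus:paper:arxiv-1707.01986 p.3-4]; crossref:
doi:10.1063/1.4738636 Jia–Seregin–Šverák 2012, doi:10.1007/s10958-013-1561-9); lit search '"Stokes
equations with drift"' (local: [corpus:paper:arxiv-1609.09736 p.2,3,8]); lit galaxy search "Stokes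
system with drift|Stokes equations with drift|divergence-free drifts" --star all and --star pdf:
galaxyd "queued too long (> 90 s)" twice — no galaxy hits obtainable this session (null recorded);
in-tree grep of Theorems/ for drift|Liouville (370 files; nearest:
SymmetryModuliCountFiniteTangentModuliMildSmallDrift = linearised class, small constant;
TypeILiouville L-stubs = KNSS drift-mild decomposition, nonlinear); ledger idea list (1 card:
linear-liouville-drifted-stokes, graded variant); the sketch's searches (SKETCH.md §Novelty: lit
search ×6, galaxy ×3, ledger negatives 5 entries none passive).
Nearest prior art found: arXiv:1609.09736 (Schonbek–Seregin, CCM 20 (2018) 1750046,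
doi:10.1142/s0219199717500468): the same programme by DUALITY — forward L¹/L² decay of the dual
drift–Stokes Cauchy problem would give the Liouville theorem and Type-I regularity; proved only for  [refs: 10.1063/1.4738636, 10.1007/s10958-013-1561-9, 10.1142/s0219199717500468, 1609.09736, 1707.01986, book:seregin2014-lecture-notes-regularity-theory-navier-stokes-equations, paper:arxiv-1707.01986, doi:10.1063/1.4738636, doi:10.1007/s10958-013-1561-9, paper:arxiv-1609.09736, doi:10.1142/s0219199717500468, SereginSilvestreSverakZlatos2012, KochNadirashviliSereginSverak2009]

Barriers (technique_class: linear-liouville, similarity-variables, spectral-exclusion): - technique_class: linear-liouville, similarity-variables, spectral-exclusion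
- Literature.Barriers.NavierStokesRegularity.AveragedTypeIBlowup: INSIDE its target tier (PDL ⇒
Type-I exclusion at the L∞ rate in the mild class), so by the barrier any proof must use structure
of B not shared by Tao's symmetric cancelling averages: the line's structure is (i) LINEARITY in u
after freezing the drift (a fixed linear operator has a spectrum; the averaged quadratic equation
does not offer this reduction because its "passive" analogue is a different, averaged kernel) and
(ii) the TRANSPORT form ℙ(b·∇u), div b = 0, with its drift-independent local bounds (SSSZ) — Tao's
own named evasion "control the nonlinearity pointwise". Honest bet: the averaged passive analogue of
PDL is false and the proof must see (ii).
- Literature.Barriers.NavierStokesRegularity.TaoAveragedBlowup: its witness is Type II; it bears on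
the residual NoTypeII (which any abstract energy/function-space method cannot prove), not on PDL;
NoTypeII is declared residual, not attacked.
- Literature.Barriers.NavierStokesRegularity.TruncatedDyadicBlowup: same as TaoAveragedBlowup
(time-dependent averaged nonlinearity, Type-II-type witness) — bears on NoTypeII only.
- Literature.Barriers.NavierStokesRegularity.CheapNavierStokesBlowup: the BC5 rung (small A, Picard
contraction in the critical weighted sup norm) IS a symbol-magnitude-only argument and is consistent
with the barrier (cheap equations have small-data theory too); th

sub-problem: NavierStokesRegularity · status: draft · opened planner-type-c5bad648ca-0 2026-08-17T18:41:44Z · rev 1 · ledger route-NavierStokesRegularity-ParabolicDriftLiouville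
GENERATED by the gate from the ledger (D-0016/17). Provers cite these decls: `theorem foo : Summit.NavierStokesRegularity.NavierStokesRegularity.Theses.ParabolicDriftLiouville.<Decl> := …` in Summits/NavierStokesRegularity/NavierStokesRegularity/Theorems/<Name>.lean.
-/

namespace Summit.NavierStokesRegularity.NavierStokesRegularity.Theses.ParabolicDriftLiouville

open scoped BigOperators Topology Manifold Classical MeasureTheory ProbabilityTheory Matrix InnerProductSpace ComplexConjugate ContinuousMap
open Filter Set Function TopologicalSpace MeasureTheory

attribute [summit_statement] _root_.NavierStokesRegularity

open Literature.NS

/-- item stmt-NavierStokesRegularity-4050 · target · rank 0 · open · by planner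
why it might fail: a non-trivial Type-I ancient mild solution (a backward DSS/rotating breather, or the blow-down of a Type-I singularity, Albritton–Barker Thm 1.1) would refute it; the Leray-projected similarity operator's strain branch drifts toward the decay window for large Type-I constant.
sources: KochNadirashviliSereginSverak2009, AlbrittonBarkerJMFM2019, PineauVicol2026, Seregin2014Notes
[target] X = (L') in the KNSS gauge: every element of A_C := {u smooth on (-inf,0)xR^3, div-free,
KNSS-mild (Oseen integral equation u(t)(x) = heatFlow(u(s))(t-s)(x) - ∫_{τ∈(s,t)} ∫_y oseenKernel
(t-τ) (x-y) (u τ y) (u τ y) for all s<t<0, i.e. u(t) = e^{(t-s)Δ}u(s) - oseenDuhamel 1 s u u t of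
NSBoundedMildOseen.lean written out with the in-tree oseenKernel: the gauge without parasitic b(t) /
time-dependent Galilean frames; KNSS2009 §1 (1.7)-(1.9), Seregin2014Notes Def 6.3 p.109, p.113),
HasTypeITimeDecay C u (|u| <= C/sqrt(-t))} is identically zero on t<0. Equivalent to ForcedSymmetry
∧ SymmetricLiouville (Sketch.lean: X ⇒ each; both ⇒ X trivially). Implied by (L) =
stmt-NavierStokesRegularity-0057 (support LiouvilleConjectureImplies). Kills Type-I blow-up via
LiouvilleKillsTypeI. [sources: KNSS2009 §1, §6 Prop 6.1; AlbrittonBarker2019 Thm 1.1;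
Seregin2014Notes pp.109-114; SereginSverak2009 §4] -/
@[route_item "route-NavierStokesRegularity-ParabolicDriftLiouville"]
def TypeIAncientLiouville : Prop :=
  ∀ (C : ℝ) (u : ℝ → EuclideanSpace ℝ (Fin 3) → EuclideanSpace ℝ (Fin 3)), ContDiffOn ℝ (⊤ : ℕ∞) (Function.uncurry u) (Set.Iio 0 ×ˢ Set.univ) ∧ (∀ t < 0, Literature.Analysis.FluidPDE.VectorCalculus.IsDivFree (u t)) ∧ (∀ s t : ℝ, s < t → t < 0 → ∀ x, u t x = Literature.Analysis.FluidPDE.heatFlow (u s) (t - s) x - ∫ τ in Set.Ioo s t, ∫ y, Literature.Analysis.FluidPDE.oseenKernel (t - τ) (x - y) (u τ y) (u τ y)) ∧ Literature.Analysis.FluidPDE.HasTypeITimeDecay C u → ∀ t < 0, ∀ x, u t x = 0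

/-- item stmt-NavierStokesRegularity-19503 · crux · rank 2 · open · by planner
why it might fail: A is scale-critical: for large A nothing excludes an eigenvalue μ of the non-self-adjoint OU–Stokes operator −Δ+(y/2)·∇+Aℙ∇·(B⊗·) with −3/4 ≤ Re μ ≤ −1/2, i.e. a passive self-similar mode u=(1−t)^μ W(x/√(1−t)) in the class; the sketch's Galerkin strain-branch fit reaches the strip near A≈400.
sources: arXiv:1609.09736, arXiv:1707.01986, SereginSilvestreSverakZlatos2012, KochNadirashviliSereginSverak2009, paper:arxiv-2506.14533
[crux] (deciding crux; card linear-liouville-drifted-stokes C1 re-targeted to the parabolic class)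
for all reals A, C and T > 0, every smooth divergence-free drift b on ℝ³ × (−∞,0) with |b(x,t)| ≤
A/√(T−t) and every smooth divergence-free u with |u(x,t)| ≤ C/√(T−t) satisfying the drifted KNSS
mild identity u(t) = e^{(t−s)Δ}u(s) − ∫ₛᵗ∫ K(t−τ, x−y)(b(τ,y), u(τ,y)) dy dτ for all s < t < 0 (K =
the tree's oseenKernel, drift in the first slot): u ≡ 0 on t < 0. [difficulty: XL] -/
@[route_item "route-NavierStokesRegularity-ParabolicDriftLiouville", crux (experiment := "instrument: bove); BLOCKER OF RECORD \"G03\" (census v44 §9, byte-unchanged through v55): ROOT <=> U AND P1 exactly, where U = no Type-II blow-up = `NoTy…") (source := "director NS l.108, 2026-09-01")]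
def ParabolicDriftLiouville : Prop :=
  ∀ (A C T : ℝ) (b u : ℝ → EuclideanSpace ℝ (Fin 3) → EuclideanSpace ℝ (Fin 3)), 0 < T → ContDiffOn ℝ (⊤ : ℕ∞) (Function.uncurry b) (Set.Iio 0 ×ˢ Set.univ) → (∀ t < 0, Literature.Analysis.FluidPDE.VectorCalculus.IsDivFree (b t)) → (∀ t < 0, ∀ x, ‖b t x‖ ≤ A / Real.sqrt (T - t)) → ContDiffOn ℝ (⊤ : ℕ∞) (Function.uncurry u) (Set.Iio 0 ×ˢ Set.univ) → (∀ t < 0, Literature.Analysis.FluidPDE.VectorCalculus.IsDivFree (u t)) → (∀ s t : ℝ, s < t → t < 0 → ∀ x, u t x = Literature.Analysis.FluidPDE.heatFlow (u s) (t - s) x - ∫ τ in Set.Ioo s t, ∫ y, Literature.Analysis.FluidPDE.oseenKernel (t - τ) (x - y) (b τ y) (u τ y)) → (∀ t < 0, ∀ x, ‖u t x‖ ≤ C / Real.sqrt (T - t)) → ∀ t < 0, ∀ x, u t x = 0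

/-- item stmt-NavierStokesRegularity-0056 · crux · rank 3 · open · by planner
why it might fail: Type-II blow-up (rate faster than (T−t)^{-1/2}) is exactly what Tao's averaged Navier–Stokes exhibits and what Hou's 2022 axisymmetric numerics suggest for true NS; no mechanism of this route bears on it.
sources: Tao2016AveragedNS, Hou2022PotentiallySingularNS, BarkerPrange2021
If a finite-energy classical solution from a rapidly decaying datum has maximal lifespan T<∞ (no
classical extension past T), then ‖u(t)‖_∞ ≤ C (T−t)^{-1/2} eventually as t↑T (Leray's rate is the
matching lower bound, leray_blowup_rate_top). The hardest and most informative crux: a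
counterexample is a Type II singularity, i.e. ¬(Clay A). Known: lower bound c√ν (T−t)^{-1/2} (Leray
1934 §20); L³ must blow up (ESS 2003, Seregin 2012); only triple-log quantitative gain (Tao 2021). -/
@[route_item "route-NavierStokesRegularity-ParabolicDriftLiouville", crux]
def NoTypeII : Prop :=
  ∀ (ν T : ℝ), 0 < ν → 0 < T → ∀ (u : ℝ → EuclideanSpace ℝ (Fin 3) → EuclideanSpace ℝ (Fin 3)) (p : ℝ → EuclideanSpace ℝ (Fin 3) → ℝ), Literature.Analysis.FluidPDE.IsMaximalSmoothSolution ν 0 u p T → Literature.Analysis.FluidPDE.IsLerayHopfOn T ν 0 (u 0) u → Literature.Analysis.FluidPDE.HasRapidSpatialDecay (u 0) → Literature.Analysis.FluidPDE.IsTypeIBlowup u T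

/-- item stmt-NavierStokesRegularity-19704 · crux · rank 4 · open · by planner
why it might fail: Uncontrolled N=5 Galerkin extrapolation; energy forbids finite-energy passive modes with Re μ ≤ −3/4 and the scalar sector has none, so the strip −3/4 ≤ Re μ ≤ −1/2 may be empty for every smooth div-free profile B (then PDL holds and this item is false).
sources: arXiv:1609.09736, KochNadirashviliSereginSverak2009, paper:arxiv-2506.14533
[crux] KILL PATH (negative companion of the deciding crux): one smooth divergence-free drift b with
|b| ≤ A/√(T−t) and one non-zero passive ancient mild solution u with |u| ≤ C/√(T−t). Why it might be
provable: the strain-branch Galerkin fit μ(A) ≈ 0.196 − 0.159 ln(A/5) of the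
Ornstein–Uhlenbeck–Stokes operator 𝒜_B enters the admissible strip −3/4 ≤ Re μ ≤ −1/2 near A ≈ 400;
a certified (interval-arithmetic) eigenpair of 𝒜_B in the strip for a Gaussian-localised div-free
profile B, plus the self-similar lift, is a single-witness refutation. Why it might fail: the fit is
an uncontrolled N=5 Galerkin extrapolation; energy forbids finite-energy modes with Re μ ≤ −3/4 and
the scalar sector has none at all. Sources: arXiv:1609.09736 (duality programme, small c_d only),
KochNadirashviliSereginSverak2009, sketch mwave/parabolic-drift-liouville §Kill. -/
@[route_item "route-NavierStokesRegularity-ParabolicDriftLiouville"]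
def NotParabolicDriftLiouville : Prop :=
  ¬ (ParabolicDriftLiouville)

/-- item stmt-NavierStokesRegularity-19504 · support · rank 9 · closed · proved by Summit.NavierStokesRegularity.NavierStokesRegularity.Theorems.parabolicDriftLiouville_diagonalContainment_proof (prover) · by planner
sources: KochNadirashviliSereginSverak2009, AlbrittonBarkerJMFM2019
[support] the diagonal embedding b := u: ParabolicDriftLiouville implies TypeIAncientLiouville (time
shift t ↦ t−1 puts a Type-I ancient mild solution into the parabolic class with T = 1, A = C; the
passive Liouville kills it on t < −1; the proved BackwardEndVanishing stmt-14064 finishes). Proved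
in the seat's Sketch.lean (diagonalContainment_holds, 20 lines) — kept as an open support binder of
`closes` for a prover to land. [difficulty: provable-now] -/
@[route_item "route-NavierStokesRegularity-ParabolicDriftLiouville", crux]
def DiagonalContainment : Prop :=
  ParabolicDriftLiouville → TypeIAncientLiouville

-- `DiagonalContainment` holds: proved by `Summit.NavierStokesRegularity.NavierStokesRegularity.Theorems.parabolicDriftLiouville_diagonalContainment_proof` (its module imports this route file, so no `_holds` link can be stated here).

/-- item stmt-NavierStokesRegularity-19505 · assembly · rank 1 · closed · proved by Summit.NavierStokesRegularity.NavierStokesRegularity.Theorems.parabolicDriftLiouville_assembly_proof (prover) · by planner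
sources: KochNadirashviliSereginSverak2009, AlbrittonBarkerJMFM2019
[assembly] ParabolicDriftLiouville → DiagonalContainment → NoTypeII → the Clay statement (A). -/
@[route_item "route-NavierStokesRegularity-ParabolicDriftLiouville"]
def Assembly : Prop :=
  ParabolicDriftLiouville → DiagonalContainment → NoTypeII → NavierStokesRegularity

-- `Assembly` holds: proved by `Summit.NavierStokesRegularity.NavierStokesRegularity.Theorems.parabolicDriftLiouville_assembly_proof` (its module imports this route file, so no `_holds` link can be stated here).

/-! D-0027 §2.1 — DECIDING THEOREM (planner-authored via `route open/edit --closes-file`; by planner-type-c5bad648ca-0 2026-08-17T18:41:44Z):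
its hypotheses are this route's items and its conclusion the sub-problem Statement (glue_lint), and it elaborates with this file. -/

@[closes "route-NavierStokesRegularity-ParabolicDriftLiouville"] theorem closes (h₁ : ParabolicDriftLiouville) (h₂ : DiagonalContainment) (h₃ : NoTypeII) :
    NavierStokesRegularity := by
  have hA : Assembly := by
    intro k₁ k₂ k₃
    have hX : TypeIAncientLiouville := k₂ k₁
    refine _root_.Summit.NavierStokesRegularity.NavierStokesRegularity.Theorems.typeICertificateLadder_noBlowupToClay_proof ?_
    intro ν T hν hT u p hcl hLH hdec
    by_contra hext
    exact hext (_root_.Summit.NavierStokesRegularity.NavierStokesRegularity.Theorems.symmetryModuliCount_liouvilleKillsTypeI_proof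
      hX ν T hν hT u p hcl hLH hdec (k₃ ν T hν hT u p ⟨hcl, hext⟩ hLH hdec))
  exact hA h₁ h₂ h₃

end Summit.NavierStokesRegularity.NavierStokesRegularity.Theses.ParabolicDriftLiouville
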